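import Summits.AtomisticToContinuum.Crystallization.Theses.PalmUnimodularRigidity
import Summits.AtomisticToContinuum.Crystallization.Theorems.PalmUnimodularRigidityBenjaminiSchrammLimitCampbell
import Summits.AtomisticToContinuum.Crystallization.Theorems.PalmUnimodularRigidityBenjaminiSchrammLimitEnergy
import Mathlib.MeasureTheory.Measure.Prokhorov
import Mathlib.MeasureTheory.Measure.Portmanteau
import Mathlib.MeasureTheory.Measure.LevyProkhorovMetric
import Mathlib.Probability.Kernel.Composition.MeasureCompProd

/-!
# Route `PalmUnimodularRigidity`, item stmt-AtomisticToContinuum-9230 `BenjaminiSchrammLimit`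

**The Benjamini–Schramm (local weak) limit of Lennard-Jones ground states**, constructed:
for every sequence of ground states `x^N` in `ℝ³` there are a subsequence `φ`, a hard core `δ > 0`
and a probability law `P` on rooted `δ`-separated counting measures which is point-stationary
(Mecke / mass-transport identity), has mean root energy `lim_j E(φ j)/φ j`, and is the local limit
of the uniformly re-rooted `x^(φ j)` in the density-transfer (portmanteau) form used by the route's
assembly (`benjaminiSchrammLimit_proof`).

Construction (the objective method of Aldous–Steele / Aldous–Lyons for hard-core point
configurations): `δ = 1/3` from `LennardJonesMinimalDistance_holds`; the uniformly rooted
empirical laws `P_N = (1/N) ∑ᵢ δ_{x^N seen from xᵢ}` live on the compact metric space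
`RootedHardCoreConfig ℝ³ δ` of rooted `δ`-hard-core configurations with the local rubber metric
(Literature `Probability/Process`), where Prokhorov's theorem (Mathlib) extracts a weakly
convergent subsequence; mass transport is an exact finite double count (`map_reroot_compProd_emp`)
and passes to the limit (helper file `…Campbell`); `E_{P_N}[h] = E(N)/N` exactly
(`integral_rootEnergy_emp`, `RootEnergy.lean`) and the root energy is a continuous local functional
(helper file `…Energy`); open matching events pass to the limit by the portmanteau theorem
(`LocalConfig.isOpen_setOf_locallyMatches`); and the limit is pushed to `Measure (Measure ℝ³)`
along the measurable embedding `S ↦ count|S` (helper file `…Embedding`), which preserves all outer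
measures and all iterated integrals.
-/

noncomputable section

open MeasureTheory Set Filter Metric TopologicalSpace ProbabilityTheory
open scoped Topology ENNReal NNReal Classical BoundedContinuousFunction

namespace Summit.AtomisticToContinuum.Crystallization.Theorems.BenjaminiSchrammLimit

open Literature.Probability.Process Literature.Probability.Process.LocalConfig
open Literature.MathematicalPhysics.StatisticalMechanics

/-- `ℝ³`. -/
local notation "E3" => EuclideanSpace ℝ (Fin 3)

variable {δ : ℝ}

set_option quotPrecheck false in
/-- The re-rooting involution `Θ (S, y) = (S - y, -y)` of the Campbell measure. -/
local notation "Θ" => fun p : RootedHardCoreConfig E3 δ × E3 =>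
  ((if h : p.2 ∈ ((p.1.1 : LocalConfig E3) : Set E3) then p.1.reroot p.2 h else p.1 :
    RootedHardCoreConfig E3 δ), -p.2)

set_option quotPrecheck false in
/-- The counting-measure kernel `S ↦ count|S`. -/
local notation "κ₀" => (⟨fun S : RootedHardCoreConfig E3 δ => (S.1 : LocalConfig E3).toMeasure,
  measurable_toMeasure (Fact.out : 0 < δ)⟩ : Kernel (RootedHardCoreConfig E3 δ) E3)

set_option quotPrecheck false in
/-- The uniformly rooted empirical law `(1/N) ∑ᵢ δ_{x seen from xᵢ}` of a finite configuration on
the space of rooted `δ`-hard-core configurations. -/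
local notation "emp[" N ", " x ", " hsep "]" =>
  (((N : ℕ) : ℝ≥0∞)⁻¹ • ∑ i : Fin N, (Measure.dirac (RootedHardCoreConfig.ofFinite x hsep i) :
    Measure (RootedHardCoreConfig E3 δ)))

/-! ### The uniformly rooted empirical law of a finite configuration -/

section Empirical

variable {N : ℕ} {x : Fin N → E3} {hsep : ∀ j k, j ≠ k → δ ≤ dist (x j) (x k)} [Fact (0 < δ)]

omit [Fact (0 < δ)] in
/-- The empirical rooted law is a probability law (`N ≠ 0`). [folklore] -/
theorem isProbabilityMeasure_emp [NeZero N] : IsProbabilityMeasure emp[N, x, hsep] := by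
  constructor
  simp only [Measure.smul_apply, Measure.coe_finsetSum, Finset.sum_apply, measure_univ,
    Finset.sum_const, Finset.card_univ, Fintype.card_fin, smul_eq_mul, nsmul_eq_mul, mul_one]
  exact ENNReal.inv_mul_cancel (by exact_mod_cast (NeZero.ne N)) (ENNReal.natCast_ne_top N)

/-- Expectations under the empirical rooted law (`ℝ≥0∞`-valued). [folklore] -/
theorem lintegral_emp (G : RootedHardCoreConfig E3 δ → ℝ≥0∞) :
    ∫⁻ S, G S ∂emp[N, x, hsep] = (N : ℝ≥0∞)⁻¹ * ∑ i, G (RootedHardCoreConfig.ofFinite x hsep i) := by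
  rw [lintegral_smul_measure, lintegral_finsetSum_measure]
  simp_rw [lintegral_dirac]
  rfl

/-- Expectations under the empirical rooted law (real-valued). [folklore] -/
theorem integral_emp (G : RootedHardCoreConfig E3 δ → ℝ) :
    ∫ S, G S ∂emp[N, x, hsep] = (N : ℝ)⁻¹ * ∑ i, G (RootedHardCoreConfig.ofFinite x hsep i) := by
  rw [integral_smul_measure, integral_finsetSum_measure fun i _ => integrable_dirac (by simp)]
  simp_rw [integral_dirac]
  rw [smul_eq_mul, ENNReal.toReal_inv, ENNReal.toReal_natCast]

omit [Fact (0 < δ)] in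
/-- The mass of a measurable set under the empirical rooted law is the fraction of particles whose
rooted configuration lies in it. [folklore] -/
theorem emp_apply {O : Set (RootedHardCoreConfig E3 δ)} (hO : MeasurableSet O) :
    emp[N, x, hsep] O = (N : ℝ≥0∞)⁻¹ *
      ((Finset.univ.filter fun i => RootedHardCoreConfig.ofFinite x hsep i ∈ O).card : ℕ) := by
  simp only [Measure.smul_apply, Measure.coe_finsetSum, Finset.sum_apply, smul_eq_mul,
    Measure.dirac_apply' _ hO, Set.indicator, Pi.one_apply, Finset.sum_boole]

omit [Fact (0 < δ)] in
/-- Sums over a finite configuration seen from particle `i`: `∫⁻ f d(count|{x_k - x_i}) = ∑_k f (x_k - x_i)`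
(distinct points). [folklore] -/
theorem lintegral_toMeasure_ofFinite (hx : Function.Injective x) (i : Fin N) (f : E3 → ℝ≥0∞) :
    ∫⁻ y, f y ∂(((RootedHardCoreConfig.ofFinite x hsep i).1 : LocalConfig E3).toMeasure) =
      ∑ k, f (x k - x i) := by
  have hinj : Function.Injective fun k => x k - x i := fun k l h => hx (sub_left_inj.1 h)
  rw [RootedHardCoreConfig.toMeasure_ofFinite, range_sub_eq_coe_image, count_restrict_coe_finset,
    lintegral_finsetSum_measure]
  simp_rw [lintegral_dirac]
  rw [Finset.sum_image fun k _ l _ h => hinj h]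

omit [Fact (0 < δ)] in
/-- Re-rooting the configuration seen from `xᵢ` at its point `xⱼ - xᵢ` gives the configuration seen
from `xⱼ`. [folklore] -/
theorem reroot_ofFinite (i j : Fin N)
    (h : x j - x i ∈ (((RootedHardCoreConfig.ofFinite x hsep i).1 : LocalConfig E3) : Set E3)) :
    (RootedHardCoreConfig.ofFinite x hsep i).reroot (x j - x i) h =
      RootedHardCoreConfig.ofFinite x hsep j := by
  refine Subtype.ext (LocalConfig.ext fun z => ?_)
  change z ∈ ((RootedHardCoreConfig.ofFinite x hsep i).1 : LocalConfig E3).translate (x j - x i) ↔ _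
  rw [mem_translate_iff]
  change z + (x j - x i) ∈ Set.range (fun k => x k - x i) ↔ z ∈ Set.range (fun k => x k - x j)
  constructor
  · rintro ⟨k, hk⟩
    refine ⟨k, ?_⟩
    dsimp only at hk ⊢
    rw [← sub_sub_sub_cancel_right (x k) (x j) (x i), hk, add_sub_cancel_right]
  · rintro ⟨k, hk⟩
    refine ⟨k, ?_⟩
    dsimp only at hk ⊢
    rw [← hk, sub_add_sub_cancel]

/-- **Exact finite mass transport.** The Campbell measure of the uniformly rooted empirical law of a
configuration of distinct points is invariant under the re-rooting involution: both
`∑ᵢ ∑ₖ g(x seen from xᵢ, xₖ - xᵢ)` and `∑ᵢ ∑ₖ g(x seen from xₖ, xᵢ - xₖ)` are the same double sum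
(Aldous–Lyons: uniform rooting is unimodular). [folklore] -/
theorem map_reroot_compProd_emp (hx : Function.Injective x) :
    haveI := isSFiniteKernel_toMeasure (E := E3) (δ := δ)
    (emp[N, x, hsep] ⊗ₘ κ₀).map Θ = emp[N, x, hsep] ⊗ₘ κ₀ := by
  haveI := isSFiniteKernel_toMeasure (E := E3) (δ := δ)
  have hδ : 0 < δ := Fact.out
  have hΘ : Measurable Θ := measurable_reroot hδ
  have hΘik : ∀ i k : Fin N, Θ (RootedHardCoreConfig.ofFinite x hsep i, x k - x i) =
      (RootedHardCoreConfig.ofFinite x hsep k, x i - x k) := fun i k => by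
    have hmem : x k - x i ∈ (((RootedHardCoreConfig.ofFinite x hsep i).1 : LocalConfig E3) :
        Set E3) := ⟨k, rfl⟩
    simp only [dif_pos hmem, reroot_ofFinite, neg_sub]
  have key : ∀ g : RootedHardCoreConfig E3 δ × E3 → ℝ≥0∞, Measurable g →
      ∫⁻ p, g (Θ p) ∂(emp[N, x, hsep] ⊗ₘ κ₀) = ∫⁻ p, g p ∂(emp[N, x, hsep] ⊗ₘ κ₀) := by
    intro g hg
    rw [Measure.lintegral_compProd (μ := emp[N, x, hsep]) (κ := κ₀) (f := fun p => g (Θ p))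
        (hg.comp hΘ), Measure.lintegral_compProd (μ := emp[N, x, hsep]) (κ := κ₀) hg,
      lintegral_emp, lintegral_emp]
    congr 1
    change ∑ i, ∫⁻ y, g (Θ (RootedHardCoreConfig.ofFinite x hsep i, y))
        ∂(((RootedHardCoreConfig.ofFinite x hsep i).1 : LocalConfig E3).toMeasure) =
      ∑ i, ∫⁻ y, g (RootedHardCoreConfig.ofFinite x hsep i, y)
        ∂(((RootedHardCoreConfig.ofFinite x hsep i).1 : LocalConfig E3).toMeasure)
    simp_rw [lintegral_toMeasure_ofFinite hx]
    simp_rw [hΘik]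
    exact Finset.sum_comm
  ext s hs
  rw [Measure.map_apply hΘ hs]
  have h1 := key (s.indicator 1) (measurable_one.indicator hs)
  rw [lintegral_indicator_one hs] at h1
  rw [← h1, ← lintegral_indicator_one (hΘ hs)]
  refine lintegral_congr fun p => ?_
  simp only [Set.indicator, Set.mem_preimage, Pi.one_apply]

/-- **Exact energy identity** `E_{P_N}[h] = 𝓔_N(x)/N`: the mean root energy of the uniformly rooted
empirical law of a configuration of distinct points is its Lennard-Jones energy per particle
(`sum_rootEnergy_rooted_lennardJones`). [folklore] -/
theorem integral_rootEnergy_emp (hx : Function.Injective x) :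
    ∫ S, (∫ y, lennardJones ‖y‖ ∂((S.1 : LocalConfig E3).toMeasure)) / 2 ∂emp[N, x, hsep] =
      interactionEnergy lennardJones x / N := by
  rw [integral_emp, div_eq_inv_mul]
  congr 1
  exact sum_rootEnergy_rooted_lennardJones hx

end Empirical

/-! ### The limit along a `δ`-separated sequence -/

/-- **The Benjamini–Schramm limit along a sequence of `δ`-separated ground states** (`δ > 0` fixed):
the conclusion of `BenjaminiSchrammLimit` with this `δ`. The uniformly rooted empirical laws on the
compact metric space of rooted `δ`-hard-core configurations have a weakly convergent subsequence
(Prokhorov); exact finite mass transport passes to the limit (`map_reroot_compProd_eq_of_tendsto`,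
`isPointStationaryLaw_map_toMeasure`); the root energy is a continuous local functional
(`continuous_integral_lennardJones_toMeasure`) and `E_{P_N}[h] = E(N)/N` exactly; open matching
events pass to the limit by the portmanteau theorem; the limit law is pushed to `Measure (Measure ℝ³)`
along the measurable embedding `S ↦ count|S`. [folklore] -/
theorem exists_limit [Fact (0 < δ)] (x : (N : ℕ) → (Fin N → E3))
    (hx : ∀ N, IsGroundState lennardJones (x N))
    (hsepx : ∀ (N : ℕ) (i j : Fin N), i ≠ j → δ ≤ dist (x N i) (x N j)) :
    ∃ φ : ℕ → ℕ, StrictMono φ ∧ ∃ P : Measure (Measure E3), IsProbabilityMeasure P ∧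
      (∀ᵐ μ ∂P, (∃ S : Set E3, (0 : E3) ∈ S ∧ (∀ x ∈ S, ∀ y ∈ S, x ≠ y → δ ≤ dist x y) ∧
        μ = (Measure.count : Measure E3).restrict S)) ∧
      (∀ g : Measure E3 → E3 → ℝ≥0∞, Measurable (Function.uncurry g) →
        ∫⁻ μ, ∫⁻ y, g μ y ∂μ ∂P = ∫⁻ μ, ∫⁻ y, g (Measure.map (fun z => z - y) μ) (-y) ∂μ ∂P) ∧
      Tendsto (fun j : ℕ => groundStateEnergy lennardJones 3 (φ j) / (φ j : ℝ)) atTop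
        (𝓝 (∫ μ, (∫ y, lennardJones ‖y‖ ∂μ) / 2 ∂P)) ∧
      ∀ T : Set (Measure E3), ∀ R ε : ℝ, 0 < ε → ∀ ρ : ℝ, ρ < (P T).toReal →
        ∀ᶠ j : ℕ in atTop, ρ * (φ j : ℝ) ≤ (Nat.card {i : Fin (φ j) // ∃ ν ∈ T,
          ((∀ p : E3, ν {p} ≠ 0 → ‖p‖ ≤ R →
              ∃ q ∈ (Set.range (fun k : Fin (φ j) => x (φ j) k - x (φ j) i)), dist q p ≤ ε) ∧
            (∀ q ∈ (Set.range (fun k : Fin (φ j) => x (φ j) k - x (φ j) i)), ‖q‖ ≤ R →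
              ∃ p : E3, ν {p} ≠ 0 ∧ dist q p ≤ ε))} : ℝ) := by
  have hδ : 0 < δ := Fact.out
  have hsep : ∀ N : ℕ, ∀ j k : Fin (N + 1), j ≠ k → δ ≤ dist (x (N + 1) j) (x (N + 1) k) :=
    fun N j k hjk => hsepx (N + 1) j k hjk
  -- the empirical rooted laws on the compact metric space of rooted `δ`-hard-core configurations
  have hprob : ∀ N : ℕ, IsProbabilityMeasure emp[N + 1, x (N + 1), hsep N] := fun N =>
    isProbabilityMeasure_emp
  set Qs : ℕ → ProbabilityMeasure (RootedHardCoreConfig E3 δ) := fun N =>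
    ⟨emp[N + 1, x (N + 1), hsep N], hprob N⟩ with hQs_def
  -- Prokhorov: a weakly convergent subsequence
  obtain ⟨Q, ψ, hψ, hlim⟩ := CompactSpace.tendsto_subseq Qs
  set e : RootedHardCoreConfig E3 δ → Measure E3 := fun S => (S.1 : LocalConfig E3).toMeasure
    with he_def
  have hE : MeasurableEmbedding e := measurableEmbedding_toMeasure E3
  haveI := isSFiniteKernel_toMeasure (E := E3) (δ := δ)
  have hinvN : ∀ n, ((Qs (ψ n) : Measure (RootedHardCoreConfig E3 δ)) ⊗ₘ κ₀).map Θ =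
      (Qs (ψ n) : Measure (RootedHardCoreConfig E3 δ)) ⊗ₘ κ₀ := fun n =>
    map_reroot_compProd_emp (hx _).1
  have hinv := map_reroot_compProd_eq_of_tendsto hlim hinvN
  refine ⟨fun j => ψ j + 1, fun a b hab => Nat.succ_lt_succ (hψ hab),
    (Q : Measure (RootedHardCoreConfig E3 δ)).map e, Measure.isProbabilityMeasure_map hE.measurable.aemeasurable,
    ?_, ?_, ?_, ?_⟩
  · -- almost surely a rooted `δ`-hard-core counting measure
    exact (hE.ae_map_iff).2 (Eventually.of_forall fun S =>
      (isRootedHardCore_toMeasure_iff δ S.1).2 S.2)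
  · -- point-stationarity
    exact isPointStationaryLaw_map_toMeasure hinv
  · -- the mean root energy
    rw [hE.integral_map]
    set H : RootedHardCoreConfig E3 δ →ᵇ ℝ := BoundedContinuousFunction.mkOfCompact
      ⟨fun S => (∫ y, lennardJones ‖y‖ ∂((S.1 : LocalConfig E3).toMeasure)) / 2,
        (continuous_integral_lennardJones_toMeasure hδ).div_const 2⟩ with hH_def
    have hlimH := (ProbabilityMeasure.tendsto_iff_forall_integral_tendsto.1 hlim) H
    refine (hlimH.congr fun j => ?_)
    change ∫ S, (∫ y, lennardJones ‖y‖ ∂((S.1 : LocalConfig E3).toMeasure)) / 2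
      ∂emp[ψ j + 1, x (ψ j + 1), hsep (ψ j)] = _
    rw [integral_rootEnergy_emp (hx _).1, (hx _).2, Nat.cast_succ]
  · -- density transfer (portmanteau with open fattenings)
    intro T R ε hε ρ hρ
    by_cases hρ0 : ρ < 0
    · exact Eventually.of_forall fun j =>
        (mul_nonpos_of_nonpos_of_nonneg hρ0.le (Nat.cast_nonneg _)).trans (Nat.cast_nonneg _)
    rw [not_lt] at hρ0
    -- the open fattening `O` of `e ⁻¹' T`
    set O : Set (RootedHardCoreConfig E3 δ) := {S | ∃ S₀ : RootedHardCoreConfig E3 δ, e S₀ ∈ T ∧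
      ∃ R' ε', R < R' ∧ 0 ≤ ε' ∧ ε' < ε ∧
        LocallyMatches R' ε' ((S₀.1 : LocalConfig E3) : Set E3) ((S.1 : LocalConfig E3) : Set E3)}
      with hO_def
    have hO : IsOpen O := by
      have : O = ⋃ S₀ ∈ {S₀ : RootedHardCoreConfig E3 δ | e S₀ ∈ T},
          Subtype.val ⁻¹' {S : LocalConfig E3 | ∃ R' ε', R < R' ∧ 0 ≤ ε' ∧ ε' < ε ∧
            LocallyMatches R' ε' ((S₀.1 : LocalConfig E3) : Set E3) (S : Set E3)} := by
        ext S
        simp only [hO_def, mem_setOf_eq, mem_iUnion, mem_preimage, exists_prop]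
      rw [this]
      exact isOpen_biUnion fun S₀ _ =>
        (isOpen_setOf_locallyMatches _ R ε).preimage continuous_subtype_val
    have hTO : e ⁻¹' T ⊆ O := fun S hS =>
      ⟨S, hS, R + 1, ε / 2, by linarith, by linarith, by linarith, locallyMatches_self (by linarith) _ _⟩
    -- portmanteau
    have hPT : ((Q : Measure (RootedHardCoreConfig E3 δ)).map e) T ≤
        (Q : Measure (RootedHardCoreConfig E3 δ)) O := by
      rw [hE.map_apply]
      exact measure_mono hTO
    have hρO : ENNReal.ofReal ρ < (Q : Measure (RootedHardCoreConfig E3 δ)) O := by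
      rw [ENNReal.ofReal_lt_iff_lt_toReal hρ0 (measure_ne_top _ _)]
      exact hρ.trans_le (ENNReal.toReal_mono (measure_ne_top _ _) hPT)
    have hliminf := ProbabilityMeasure.le_liminf_measure_open_of_tendsto hlim hO
    have hev : ∀ᶠ j in atTop, ENNReal.ofReal ρ <
        (Qs (ψ j) : Measure (RootedHardCoreConfig E3 δ)) O :=
      eventually_lt_of_lt_liminf (hρO.trans_le hliminf)
    filter_upwards [hev] with j hj
    -- counting
    change ENNReal.ofReal ρ < emp[ψ j + 1, x (ψ j + 1), hsep (ψ j)] O at hj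
    rw [emp_apply hO.measurableSet, ENNReal.ofReal_lt_iff_lt_toReal hρ0
      (ENNReal.mul_ne_top (ENNReal.inv_ne_top.2 (Nat.cast_ne_zero.2 (Nat.succ_ne_zero _)))
        (ENNReal.natCast_ne_top _)),
      ENNReal.toReal_mul, ENNReal.toReal_inv, ENNReal.toReal_natCast, ENNReal.toReal_natCast,
      inv_mul_eq_div, lt_div_iff₀ (by positivity)] at hj
    refine hj.le.trans ?_
    have hsub : ∀ i : Fin (ψ j + 1), RootedHardCoreConfig.ofFinite (x (ψ j + 1)) (hsep (ψ j)) i ∈ O →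
        ∃ ν ∈ T, LocallyMatches R ε (Set.range fun k : Fin (ψ j + 1) => x (ψ j + 1) k - x (ψ j + 1) i)
          (atoms ν) := by
      rintro i ⟨S₀, hS₀T, R', ε', hR', -, hε', hm⟩
      refine ⟨e S₀, hS₀T, ?_⟩
      rw [he_def]
      dsimp only
      rw [atoms_toMeasure]
      exact hm.symm.mono hR'.le hε'.le
    rw [Nat.card_eq_fintype_card, Fintype.card_subtype]
    exact_mod_cast Finset.card_le_card (Finset.monotone_filter_right _ fun i _ hi => hsub i hi)

/-! ### The theorem -/

/-- **Item `stmt-AtomisticToContinuum-9230` (`BenjaminiSchrammLimit`, route `PalmUnimodularRigidity`):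
the Benjamini–Schramm limit of Lennard-Jones ground states.** For every sequence of ground states
`x^N` there are a subsequence `φ`, a hard core `δ > 0` and a probability law `P` on rooted
`δ`-separated counting measures which is point-stationary (Mecke / mass-transport identity), whose
mean root energy is `lim E(φ j)/φ j`, and to which the uniformly re-rooted `x^(φ j)` converge in the
density-transfer form. The hard core is that of `LennardJonesMinimalDistance_holds` (`δ = 1/3`);
the rest is `exists_limit`. -/
theorem _root_.Summit.AtomisticToContinuum.Crystallization.Theorems.benjaminiSchrammLimit_proof :
    Summit.AtomisticToContinuum.Crystallization.Theses.PalmUnimodularRigidity.BenjaminiSchrammLimit := by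
  unfold Summit.AtomisticToContinuum.Crystallization.Theses.PalmUnimodularRigidity.BenjaminiSchrammLimit
  intro x hx
  obtain ⟨δ', hδ', hsepx⟩ := LennardJonesMinimalDistance_holds
  haveI : Fact (0 < δ') := ⟨hδ'⟩
  obtain ⟨φ, hφ, P, hP⟩ := exists_limit (δ := δ') x hx fun N i j hij => hsepx N (x N) (hx N) i j hij
  exact ⟨φ, hφ, δ', hδ', P, hP⟩

end Summit.AtomisticToContinuum.Crystallization.Theorems.BenjaminiSchrammLimit
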